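import Summits.HodgeConjecture.HodgeConjecture.Theses.EndoscopicMiddleDegree
import Summits.HodgeConjecture.HodgeConjecture.Theorems.OrthogonalEnveloped.Negative.EnvelopeOfAlgebraic
import Summits.HodgeConjecture.HodgeConjecture.Theorems.IsotypicMiddleClassesAlgebraic.Negative.LoadBearing
import Literature.AlgebraicGeometry.HodgeTheory.MotivatedClassesAlgebraic
import Literature.AlgebraicGeometry.HodgeTheory.GysinKernelProofs
import Literature.AlgebraicGeometry.Motives.VarietiesProjectiveSpaceProofs
import Literature.AlgebraicGeometry.Motives.VarietiesUnitProofs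
import Literature.AlgebraicGeometry.Motives.SegreEmbedding

/-!
# Disproof of `AlgebraicOrEnveloped` — standing adversary's work file (cdisprove; cycle 1, 2026-08-16)

Crux `stmt-HodgeConjecture-14943` = `EndoscopicMiddleDegree.AlgebraicOrEnveloped` (route
`route-HodgeConjecture-EndoscopicMiddleDegree`, rev 11, rank 5; THE DICHOTOMY, deciding-path form of
`OrthogonalEnveloped`; deciding theorem `closes (h₁ : IsotypicMiddleClassesAlgebraic)
(h₂ : AlgebraicOrEnveloped) (hS : SectorComplement)`). For `m ∈ {1,2}` (`n = m+1`), a datum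
`D : UnitaryBallQuotientDatum (2n) X` and HC in degree `2m` on `X`: every rational `(n,n)`-class `c`
lies in `algebraicClasses X n ⊔ span_ℂ {e rational : ∃ μ (PD), ∃ γ ∈ algebraicClasses (X ⊗ X) (2n),
P_γ preserves rational classes, has purely (n,n) image, P_γ e = e}`, `P_γ β = pr₁₊(pr₂^* β ∪ γ)`.

**NO KILL — and none is possible short of `¬HC`: the crux is implied by the route's own TARGET through
`Submodule.mem_sup_left` (F1, kernel-checked).** Findings, indexed; prose only in docstrings; every
`theorem` below is kernel-checked (this file: `lean check` rc 0, no `sorry`) unless marked PAPER.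
LANDED (Negative lane, `--supports stmt-HodgeConjecture-14943`): p98331 ACCEPTED 2026-08-16 (commit
141c5e4fb5a7) = `Summits/HodgeConjecture/HodgeConjecture/Theorems/AlgebraicOrEnveloped/Negative/Calibration.lean`
(the theorems of §§F1–F4 below, namespace `…Theorems.AlgebraicOrEnveloped.Negative.Calibration` — IMPORT IT);
companion p100130 ACCEPTED 2026-08-16 =
`Summits/HodgeConjecture/HodgeConjecture/Theorems/AlgebraicOrEnveloped/Negative/LineSketchUnderHC.lean`
(F4 on the registered stub signatures verbatim: HC ⟹ the bet `stub_shadowKernelEnveloped`, HC ⟹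
`HullShadowSplit`, shadow-kernel generators `⊆ {0}` under HC; namespace `…Negative.LineSketchUnderHC`).
USED from the sibling disprovers (import them, do not re-derive): `Theorems/OrthogonalEnveloped/Negative/
EnvelopeOfAlgebraic` (p80733; `Pc`, `crossSq`, `fibreIntegral`, `exists_pc_crossSq_eq_smul`,
`isRationalClass_pc_ratFamily_crossSq`, `exists_ratCast_eq_of_isRationalClass_smul`,
`conclusion_of_mem_algebraicClasses`, `conclusion_of_orthogonalFrame`),
`Theorems/IsotypicMiddleClassesAlgebraic/Negative/LoadBearing` (`corrAction_diagonal_apply`) and the PAPER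
analysis F5/F5b of `Cruxes/OrthogonalEnveloped/Disproof.lean` (purity count of Adams–Johnson packets; the
bet = NoImpureRationalComponents / CoreVanishing in the wide sense), which applies verbatim to the
envelope clause of this crux.

* **F0 — typing audit: clean, field-rich, no junk model.** The crux elaborates (probe rc 0); its inline
  `let P := …` is the tree's `corrAction μ D.isSmoothProjective D.isSmoothProjective rfl γ` by `rfl`
  (`pc_apply` of the sibling file; `not_corrActionForm_of_not_crux` below is `id`). The `∀`-bound datum
  forces `X(ℂ) ≃ₜ Γ\𝔹²ⁿ` (`UnitaryBallQuotientDatum.homeomorph`, PROVED from `surjOn_unif` +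
  `unif_eq_unif_iff`; `signature_τ₁` makes the cone non-empty) with `X` smooth projective of dimension
  `2n ≥ 4`: no point / empty / zero-object instance, so an unconditional `¬AlgebraicOrEnveloped` needs a
  genuine compact ball quotient, which the tree cannot build. `IsOfHodgeType` is `∃ HodgeModel`, supplied
  by the hypothesis on `c` wherever the conclusion needs it. `μ.HasPoincareDuality` is the tree's THEOREM
  `OrientationFamily.hasPoincareDuality` (free hypothesis).
* **F1 — CEILING: target ⟹ crux ⟹ nothing refutable short of ¬HC** (`not_middleDegreeStep_of_not_crux`,
  `not_middleHC_of_not_crux`, `not_hodgeConjecture_of_not_crux`, `not_split_of_not_crux`). The crux's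
  conclusion `c ∈ Alg ⊔ span{…}` follows from `c ∈ Alg` by `Submodule.mem_sup_left`; so
  `MiddleDegreeStep → AlgebraicOrEnveloped` with NO exterior square and NO Hodge–Riemann (contrast F1 of the
  sibling `OrthogonalEnveloped`, whose conclusion "enveloped" needed the normalised exterior square), and
  `HodgeConjecture → MiddleDegreeStep`. A kill is therefore a non-algebraic rational Hodge class on a compact
  arithmetic `4`- or `6`-ball quotient; inside the route it would refute one of `CupProductAlgebraic`,
  `OrthogonalSplit`, `OrthogonalEnveloped` (glue `AlgebraicOrEnvelopedOfSplit`, PROVED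
  `algebraicOrEnvelopedOfSplit_proof`). With `IsotypicMiddleClassesAlgebraic` the crux is EQUIVALENT to the
  target over the sector (`closes` one way, `mem_sup_left` + "`P c = c`, `P` `(n,n)`-valued ⟹ `c` Hodge" the
  other: sibling `NoKillShortOfHC`). All risk is provability.
* **F2 — the `∃ μ` slack is VOID** (`enveloped_of_enveloped`, `setOf_enveloped_eq`): `corrAction μ' =
  c • corrAction μ`, `c ≠ 0` (tree `corrAction_eq_smul_of_orientationFamily`), and `γ ↦ c • γ` preserves the
  `ℂ`-submodule `algebraicClasses`; so the generator set `{e rational | ∃ μ PD, ∃ γ …}` equals the set at ANY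
  fixed `μ₀`. Planner's design goal (keep `ComplexPointsOrientation` out of the route cone) is met at zero
  logical cost; provers should fix `μ₀` (e.g. the rationally normalised `ratFamily` of
  `NikulinSerreCarrier/Negative/OrientationTwist`, whose Gysin maps preserve rationality).
* **F3 — LOAD-BEARING ANALYSIS (which clause carries the content).** No `_false_without_` lemma exists for
  ANY hypothesis (F1: even the fully stripped statement is HC-implied). Instead, `_holds_without_`:
  (a) BARE FORM (`bareForm_holds`): generators with an ARBITRARY map `P` (three properties kept) make the
  crux a triviality (`P ≡ c`) — all content is the SHAPE `P = [γ]_*`, `γ` algebraic (dual to the sibling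
  `IsotypicMiddleClassesAlgebraic`, whose bare form is middle HC). (b) WITHOUT THE PURITY CLAUSE "`P` has
  `(n,n)` image" the crux is a THEOREM (`withoutHodgeImage_holds`, `exists_diagonal_envelope`): `[Δ_X] =
  (𝟙,𝟙)_* 1` is algebraic (`complexGysin_graph_one_mem_algebraicClasses`) and acts as `id`
  (`corrAction_diagonal_apply`). (c) WITHOUT "`γ` ALGEBRAIC" every ANISOTROPIC rational class (`e ∪ e ≠ 0`)
  is enveloped by its normalised exterior square for every `μ` (`exists_crossSq_envelope_withoutAlgebraic`;
  rationality preservation by comparison with `ratFamily`; fibre-integral non-vanishing `ht` = Künneth, an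
  explicit hypothesis as in the sibling file) — so algebraicity of `γ` is exactly where HC enters.
  (d) RATIONALITY PRESERVATION is NOT redundant given `γ ∈ algebraicClasses` (a `ℂ`-span: `π • [Z]` is
  algebraic and its action destroys rationality); PAPER: it is what forces a Hecke envelope to be a
  `ℚ`-rational idempotent, i.e. purity at EVERY coefficient conjugate (the sieve) — load-bearing for the
  route proof, not for truth. (e) `hlow` (HC in degree `2m`), `1 ≤ m ≤ 2`, `IsOfHodgeType c`: idle for truth
  (F1 never uses them); `hlow` is load-bearing for the LINE (non-degeneracy of the cup form on
  `Alg ∩ Hdg_ℚ ⊇ L·Hdg^{n-1,n-1}_ℚ`, stub `stub_algebraicKernelSplit`). (f) The SPAN: the conclusion asks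
  `c ∈ Alg + span_ℂ(enveloped)`, not "`c - a` enveloped"; sums of enveloped classes need not be enveloped by
  ONE `γ` without composing correspondences — the span is the right (weakest) contract for `closes`, which
  applies `IsotypicMiddleClassesAlgebraic` generator by generator (`span_le`).
* **F4 — LINE `Sketch` (hull-gysin-dichotomy; PICKED): no stub refutable short of ¬HC; retract hulls.**
  (`eq_zero_of_complexGysin_eq_zero_of_retract`, `exists_product_retract`,
  `shadowKernel_eq_zero_of_admissible_retract`, `shadowKernel_eq_zero_of_hodgeConjecture`,
  `not_hodgeConjecture_of_shadowKernel_ne_zero`; on the REGISTERED STUB SIGNATURES verbatim: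
  `stub_shadowKernelEnveloped_of_hodgeConjecture` (HC ⟹ THE BET, vacuously),
  `hullShadowSplit_of_hodgeConjecture`, `shadowKernel_generators_subset_zero_of_hodgeConjecture`,
  `not_hodgeConjecture_of_not_stub_shadowKernelEnveloped`.) The typed `ShadowKernel μ hX e` (`ι_* e = 0` for EVERY
  smooth projective `3(m+1)`-fold `X'` with `HullHC` and every `ι : X ⟶ X'`) quantifies over the RETRACT
  HULL `X ⊗ ℙ^{m+1} ⊇ X × {pt}` (`exists_unit_hom_projectiveSpace_isClosedImmersion`,
  `isSmoothProjective_projectiveSpace_holds`, `tensor_holds`), on which `ι_*` is injective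
  (`pr₁₊ ∘ ι₊ = (ι ≫ pr₁)₊ = id`, `complexGysin_comp` + `complexGysin_id`). Its admissibility `HullHC` is a
  case of HC. HENCE: under HC the shadow kernel is `{0}`; the bet `ShadowKernelEnveloped` is HC-VACUOUS
  (true by `γ = 0`, exactly like `EnvelopedOfThetaSpan`) and a non-zero shadow-kernel class refutes HC.
  Consequences for the lead: (i) neither `stub_gysinNull` nor `stub_shadowKernelEnveloped` can be refuted by
  this seat; (ii) the hulls buy NOTHING logically over the weaker residual `AlgebraicKernelEnveloped`
  (`AlgOrthogonal ⟹ enveloped`), which with `stub_algebraicKernelSplit` already gives the crux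
  (`algebraicOrEnveloped_of_algebraicKernel` in `Lines/Sketch_remarks.lean`) — the hull enters only as the
  HANDLE by which the automorphic argument recognises `e` (Gysin-null in the MODULAR hull `Sh(U(3n,1))`,
  admissible by BMM Cor. 1.4 at `(p,n) = (3n,n)`, boundary of `]p/3,2p/3[` INCLUDED: held text p. 3 l. 67);
  (iii) `stub_gysinNull` applied to an admissible retract hull returns "`e ⊥ Alg`, `e` rational Hodge ⟹
  `e = 0`", i.e. middle HC on `X` — consistent, because admissibility of `X ⊗ Y` already contains middle HC
  on `X` (Künneth summand `pr₁^* H^{2n}(X)` + pull-back along the section). PAPER checks of the other stubs: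
  `stub_pullbackAlgebraic` (Fulton §8 lci pull-back + cycle class; TRUE, needs Deligne purity
  `N^k H^{2k} = span cl(Z)` to pass from coniveau to cycles), `stub_cupProductAlgebraic` (= support item
  14350, Fulton 19.2 / moving lemma; TRUE), `stub_algebraicKernelSplit` (TRUE given the sign-free Kähler
  package: `A := span(Alg ∩ Hdg_ℚ) = (A ∩ Prim) ⊥ L·Hdg^{2n-2}_ℚ` since `L·Hdg^{2n-2}_ℚ ⊆ A` by `hlow` +
  `CupProductAlgebraic`; anisotropy on real primitive `(p,p)` pieces ⟹ definiteness piecewise ⟹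
  non-degenerate on `A` ⟹ `Hdg_ℚ = A ⊕ (A^⊥ ∩ Hdg_ℚ)`), `stub_gysinNull` (TRUE given hard Lefschetz as an
  isomorphism of `ℚ`-HS `L^n : H^{2n}(X') ⥲ H^{4n}(X')` — which carries `Hdg` onto `Hdg` — plus HR: the
  Hodge-class pairing `Hdg^{4n}(X') × Hdg^{2n}(X') → ℚ` is then non-degenerate, and `⟨ι_*e, u⟩ =
  ⟨e, ι^*u⟩ = 0`; in the TREE this non-degeneracy is exactly the named-fact consequence
  `hardLefschetz_hodgeRiemann.hodgeClasses_cupPairing_nondegenerate` (BFNP (6.1) = the pairing on HODGE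
  classes, `k + l = d`, here `d = 3(m+1)`, `k = 2(m+1)`), already inside `stub_facts.1` — so the stub is
  correctly supplied; `ι_* e` is rational up to the orientation unit and of type `(2n,2n)` by the tree's
  Gysin lemmas). JOINT SUFFICIENCY: `AlgebraicOrEnveloped_of` is kernel-checked in the skeleton (rc 0) —
  no gap smuggled.
* **F5 (PAPER) — the automorphic content is the sibling's F5/F5b verbatim.** The envelope clause of this
  crux is the conclusion of `OrthogonalEnveloped`; by Matsushima + Arthur (Mok/KMSW) a class is
  Hecke-enveloped iff each of its Hecke-isotypic components lies in a piece PURE of type `(n,n)` in degree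
  `2n` AT EVERY COEFFICIENT CONJUGATE (rationality preservation, F3(d)). The dichotomy therefore fails iff
  some rational `(n,n)`-class has a component in an IMPURE piece ("wide core": coordinate `0` at `τ₁` inside
  a cuspidal summand `Ψ_a`, `a ≥ 2`, surviving the sieve — `Ψ₅`, `Ψ₃ ⊞ Ψ₂`, `Ψ₄ ⊞ χ` off-centre everywhere,
  …; at `m = 2` also non-tempered `Ψ₃ ⊞ ρ⊠R₂`) that is NOT already algebraic. Under HC + "Hodge ⟹ Tate"
  (irreducibility of `r(Ψ_a)`, Calegari–Gee `n ≤ 5` / Patrikis–Taylor) such components do not exist. The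
  even core `Ψ₄ ∋ 0 ⊞ χ₀` named in the item's why-might-fail is one of these; nothing in print produces a
  rational class there, and nothing in print excludes it unconditionally: it IS the bet (CoreVanishing),
  unrefutable and unavoidable.
* **F6 — natural strengthenings / variants, none refutable here.** (i) Drop `IsRationalClass c`: then the
  crux says `H^{n,n} ⊆ Hdg_ℚ ⊗ ℂ + Alg` — FALSE on any datum with `h^{n,n} > ρ` (PAPER; every compact ball
  quotient with a non-Tate piece in `H^{n,n}`), but needs a datum in Lean: not landable. (ii) Drop
  `IsOfHodgeType c`: FALSE on any datum with `H^{2n} ≠ H^{n,n}` (PAPER). (iii) `m = 0` (surfaces): the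
  statement is Lefschetz (1,1) — true; `m ≥ 3`: HC-implied (F1 is uniform in `m`). (iv) One `γ` for all
  `e` / `P` a projector / `γ` symmetric: HC-implied (sum of normalised exterior squares over an orthogonal
  algebraic frame, sibling `conclusion_of_orthogonalFrame`). (v) The set of enveloped classes in place of
  its span: HC-implied likewise. (vi) BMM boundary: the degree-`2m` hypothesis at `m = 2` (HC in degree 4 on
  `6`-ball quotients) IS BMM Cor. 1.4 (`n = 2 = p/3` allowed, open interval) — the route's reading checked
  against the held text (arXiv:1306.1515 p. 3).
* **F7 — what would change the verdict.** Only (a) a constructible datum (Lean-level existence of a compact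
  arithmetic ball quotient with its uniformization — far off), together with (b) a PAPER counterexample to HC
  on it. Short of that, every cycle of this seat can only add calibration. Recommended use of the remaining
  disprover budget: none on the crux; on the line, only the bet `stub_shadowKernelEnveloped` has content a
  disprover could ever touch, and by F4 its hypothesis is non-trivially inhabited only where HC fails —
  so the seat should be re-armed only on a lead `disprover-wanted:` request or a reshaped skeleton.

-- Targets: payload.targets = [] and payload.stuck_stubs = [] at cycle 1 (line `Sketch` registered
-- 2026-08-16T08:06:56Z; lead cycles 0). Nothing to kill yet; F4 covers the registered stubs on paper.
-/

noncomputable section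

set_option linter.dupNamespace false

namespace Summit.HodgeConjecture.HodgeConjecture.Cruxes.AlgebraicOrEnveloped.Disproof

open CategoryTheory MonoidalCategory CartesianMonoidalCategory
open Literature.AlgebraicGeometry Literature.AlgebraicGeometry.Motives
  Literature.AlgebraicGeometry.HodgeTheory Literature.AlgebraicGeometry.ShimuraVarieties
  Literature.AlgebraicTopology.SingularHomology
open Summit.HodgeConjecture.HodgeConjecture.Theses.EndoscopicMiddleDegree
open Summit.HodgeConjecture.HodgeConjecture.Theorems.OrthogonalEnveloped.Negative.EnvelopeOfAlgebraic
  (Pc pc_apply crossSq fibreIntegral two_add_two exists_pc_crossSq_eq_smul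
    isRationalClass_pc_ratFamily_crossSq exists_ratCast_eq_of_isRationalClass_smul)
open Summit.HodgeConjecture.HodgeConjecture.Theorems.NikulinSerreCarrier.Negative.OrientationTwist
  (ratFamily)
open Summit.HodgeConjecture.HodgeConjecture.Theorems.IsotypicMiddleClassesAlgebraic.Negative.LoadBearing
  (corrAction_diagonal_apply)

variable {m : ℕ} {X : SchemeOver ℂ}

/-! ## F0 — the crux in `corrAction` spelling (definitional) -/

/-- F0: the crux IS its `corrAction` spelling (`rfl` on the inline `let P`); stated as failure transfer.
[folklore] -/
theorem not_corrActionForm_of_not_crux (h : ¬ AlgebraicOrEnveloped) :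
    ¬ ∀ (m : ℕ) (X : SchemeOver ℂ) (D : UnitaryBallQuotientDatum (2 * (m + 1)) X), 1 ≤ m → m ≤ 2 →
      (∀ a : complexBetti X (2 * m), IsRationalClass a →
        IsOfHodgeType (2 * (m + 1)) X (2 * m) m m a → a ∈ algebraicClasses X m) →
      ∀ c : complexBetti X (2 * (m + 1)), IsRationalClass c →
        IsOfHodgeType (2 * (m + 1)) X (2 * (m + 1)) (m + 1) (m + 1) c →
        c ∈ algebraicClasses X (m + 1) ⊔ Submodule.span ℂ {e : complexBetti X (2 * (m + 1)) |
          IsRationalClass e ∧ ∃ μ : OrientationFamily, μ.HasPoincareDuality ∧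
            ∃ γ ∈ algebraicClasses (X ⊗ X) (2 * (m + 1)),
              (∀ β, IsRationalClass β → IsRationalClass (Pc μ D.isSmoothProjective γ β)) ∧
              (∀ β, IsOfHodgeType (2 * (m + 1)) X (2 * (m + 1)) (m + 1) (m + 1)
                (Pc μ D.isSmoothProjective γ β)) ∧
              Pc μ D.isSmoothProjective γ e = e} :=
  h

/-! ## F1 — ceiling -/

/-- F1: target ⟹ crux by `mem_sup_left`; contrapositive. [folklore] -/
theorem not_middleDegreeStep_of_not_crux (h : ¬ AlgebraicOrEnveloped) : ¬ MiddleDegreeStep := by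
  intro hM
  exact h fun m X D hm1 hm2 hlow c hc hH ↦ Submodule.mem_sup_left (hM m X hm1 hm2 ⟨D⟩ hlow c hc hH)

/-- F1: ¬crux ⟹ middle-degree HC fails on the sector (the degree-`2m` hypothesis is not needed).
[folklore] -/
theorem not_middleHC_of_not_crux (h : ¬ AlgebraicOrEnveloped) :
    ¬ ∀ (m : ℕ) (X : SchemeOver ℂ), UnitaryBallQuotientDatum (2 * (m + 1)) X → 1 ≤ m →
      m ≤ 2 → ∀ c : complexBetti X (2 * (m + 1)), IsRationalClass c →
        IsOfHodgeType (2 * (m + 1)) X (2 * (m + 1)) (m + 1) (m + 1) c →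
          c ∈ algebraicClasses X (m + 1) := by
  intro hM
  exact h fun m X D hm1 hm2 _ c hc hH ↦ Submodule.mem_sup_left (hM m X D hm1 hm2 c hc hH)

/-- F1: ¬crux ⟹ ¬HC. [cite: Deligne2000, §1] -/
theorem not_hodgeConjecture_of_not_crux (h : ¬ AlgebraicOrEnveloped) : ¬ _root_.HodgeConjecture := by
  intro hHC
  exact not_middleHC_of_not_crux h fun m _ D _ _ c hc hH ↦ (hHC D.isSmoothProjective).2 (m + 1) c hc hH

/-- F1: where a kill propagates inside the route (glue `AlgebraicOrEnvelopedOfSplit`, PROVED as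
`Theorems.algebraicOrEnvelopedOfSplit_proof`; hypothesis here to keep the cone small). [folklore] -/
theorem not_split_of_not_crux (h : ¬ AlgebraicOrEnveloped) (hglue : AlgebraicOrEnvelopedOfSplit) :
    ¬ CupProductAlgebraic ∨ ¬ OrthogonalSplit ∨ ¬ OrthogonalEnveloped := by
  by_contra hcon
  simp only [not_or, not_not] at hcon
  exact h (hglue hcon.1 hcon.2.1 hcon.2.2)

/-- F1: conversely the crux and `IsotypicMiddleClassesAlgebraic` give middle HC on the sector under the
degree-`2m` hypothesis — the body of `closes`, restated so that the equivalence "crux ∧ #3 ⟺ target" is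
on record in this file. [folklore] -/
theorem middleDegreeStep_of_crux_of_isotypic (h₁ : IsotypicMiddleClassesAlgebraic)
    (h₂ : AlgebraicOrEnveloped) : MiddleDegreeStep := by
  intro m X hm1 hm2 hD hlow c hc hH
  obtain ⟨D⟩ := hD
  refine (sup_le le_rfl ?_ : _ ≤ algebraicClasses X (m + 1)) (h₂ m X D hm1 hm2 hlow c hc hH)
  refine Submodule.span_le.2 ?_
  rintro e ⟨he, μ, hμ, γ, hγ, hrat, hhodge, hfix⟩
  exact h₁ μ hμ m X D hm1 hm2 γ hγ hrat hhodge e he hfix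

/-! ## F2 — the `∃ μ` slack is void -/

/-- F2: envelopes transfer between orientation families (`γ ↦ c • γ`). [cite: FultonYoungTableaux1997, Appendix B §B.1 (5)] -/
theorem enveloped_of_enveloped (μ μ' : OrientationFamily) (hX : IsSmoothProjective (2 * (m + 1)) X)
    {e : complexBetti X (2 * (m + 1))}
    (h : ∃ γ ∈ algebraicClasses (X ⊗ X) (2 * (m + 1)),
      (∀ β, IsRationalClass β → IsRationalClass (Pc μ hX γ β)) ∧
      (∀ β, IsOfHodgeType (2 * (m + 1)) X (2 * (m + 1)) (m + 1) (m + 1) (Pc μ hX γ β)) ∧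
      Pc μ hX γ e = e) :
    ∃ γ ∈ algebraicClasses (X ⊗ X) (2 * (m + 1)),
      (∀ β, IsRationalClass β → IsRationalClass (Pc μ' hX γ β)) ∧
      (∀ β, IsOfHodgeType (2 * (m + 1)) X (2 * (m + 1)) (m + 1) (m + 1) (Pc μ' hX γ β)) ∧
      Pc μ' hX γ e = e := by
  obtain ⟨γ, hγ, hrat, hhodge, hfix⟩ := h
  obtain ⟨c, _, hc⟩ := corrAction_eq_smul_of_orientationFamily μ'.hasPoincareDuality
    μ.hasPoincareDuality hX hX
    (rfl : 2 * (m + 1) + 2 * (2 * (m + 1)) = 2 * (m + 1) + 2 * (2 * (m + 1)))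
  have key : ∀ β, Pc μ' hX (c • γ) β = Pc μ hX γ β := by
    intro β
    change corrAction μ' hX hX rfl (c • γ) β = corrAction μ hX hX rfl γ β
    rw [map_smul, LinearMap.smul_apply, hc, LinearMap.smul_apply, LinearMap.smul_apply]
  refine ⟨c • γ, Submodule.smul_mem _ _ hγ, fun β hβ ↦ ?_, fun β ↦ ?_, ?_⟩
  · rw [key]; exact hrat β hβ
  · rw [key]; exact hhodge β
  · rw [key]; exact hfix

/-- F2: the generator set of the crux equals the one at any FIXED family `μ₀`. [cite: FultonYoungTableaux1997, Appendix B §B.1 (5)] -/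
theorem setOf_enveloped_eq (μ₀ : OrientationFamily) (hX : IsSmoothProjective (2 * (m + 1)) X) :
    {e : complexBetti X (2 * (m + 1)) | IsRationalClass e ∧ ∃ μ : OrientationFamily,
      μ.HasPoincareDuality ∧ ∃ γ ∈ algebraicClasses (X ⊗ X) (2 * (m + 1)),
        (∀ β, IsRationalClass β → IsRationalClass (Pc μ hX γ β)) ∧
        (∀ β, IsOfHodgeType (2 * (m + 1)) X (2 * (m + 1)) (m + 1) (m + 1) (Pc μ hX γ β)) ∧
        Pc μ hX γ e = e} =
    {e : complexBetti X (2 * (m + 1)) | IsRationalClass e ∧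
      ∃ γ ∈ algebraicClasses (X ⊗ X) (2 * (m + 1)),
        (∀ β, IsRationalClass β → IsRationalClass (Pc μ₀ hX γ β)) ∧
        (∀ β, IsOfHodgeType (2 * (m + 1)) X (2 * (m + 1)) (m + 1) (m + 1) (Pc μ₀ hX γ β)) ∧
        Pc μ₀ hX γ e = e} := by
  ext e
  simp only [Set.mem_setOf_eq]
  constructor
  · rintro ⟨he, μ, -, h⟩
    exact ⟨he, enveloped_of_enveloped μ μ₀ hX h⟩
  · rintro ⟨he, h⟩
    exact ⟨he, μ₀, μ₀.hasPoincareDuality, h⟩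

/-! ## F3 — load-bearing analysis: `_holds_without_` -/

/-- F3(a): BARE FORM (arbitrary `P`) is a triviality, `P ≡ c`. [folklore] -/
theorem bareForm_holds (m : ℕ) (X : SchemeOver ℂ) (c : complexBetti X (2 * (m + 1)))
    (hc : IsRationalClass c) (hH : IsOfHodgeType (2 * (m + 1)) X (2 * (m + 1)) (m + 1) (m + 1) c) :
    c ∈ algebraicClasses X (m + 1) ⊔ Submodule.span ℂ {e : complexBetti X (2 * (m + 1)) |
      IsRationalClass e ∧ ∃ P : complexBetti X (2 * (m + 1)) → complexBetti X (2 * (m + 1)),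
        (∀ β, IsRationalClass β → IsRationalClass (P β)) ∧
        (∀ β, IsOfHodgeType (2 * (m + 1)) X (2 * (m + 1)) (m + 1) (m + 1) (P β)) ∧ P e = e} :=
  Submodule.mem_sup_right (Submodule.subset_span ⟨hc, fun _ ↦ c, fun _ _ ↦ hc, fun _ ↦ hH, rfl⟩)

/-- F3(b): the diagonal envelopes every class once the purity clause is dropped.
[cite: Fulton1998, §16.1 Ex. 16.1.3] -/
theorem exists_diagonal_envelope (μ : OrientationFamily) (hX : IsSmoothProjective (2 * (m + 1)) X)
    (c : complexBetti X (2 * (m + 1))) :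
    ∃ γ ∈ algebraicClasses (X ⊗ X) (2 * (m + 1)),
      (∀ β, IsRationalClass β → IsRationalClass (Pc μ hX γ β)) ∧ Pc μ hX γ c = c := by
  refine ⟨_, complexGysin_graph_one_mem_algebraicClasses μ μ.hasPoincareDuality hX
    (IsSmoothProjective.tensor_holds hX hX) (𝟙 X), fun β hβ ↦ ?_, ?_⟩
  · change IsRationalClass (corrAction μ hX hX rfl _ β)
    rwa [corrAction_diagonal_apply μ hX (by omega)]
  · change corrAction μ hX hX rfl _ c = c
    rw [corrAction_diagonal_apply μ hX (by omega)]

/-- F3(b): the crux WITHOUT "`P` has `(n,n)` image" holds outright (same binders; only `hc` used).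
[cite: Fulton1998, §16.1 Ex. 16.1.3] -/
theorem withoutHodgeImage_holds (m : ℕ) (X : SchemeOver ℂ) (D : UnitaryBallQuotientDatum (2 * (m + 1)) X)
    (c : complexBetti X (2 * (m + 1))) (hc : IsRationalClass c) :
    c ∈ algebraicClasses X (m + 1) ⊔ Submodule.span ℂ {e : complexBetti X (2 * (m + 1)) |
      IsRationalClass e ∧ ∃ μ : OrientationFamily, μ.HasPoincareDuality ∧
        ∃ γ ∈ algebraicClasses (X ⊗ X) (2 * (m + 1)),
          (∀ β, IsRationalClass β → IsRationalClass (Pc μ D.isSmoothProjective γ β)) ∧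
          Pc μ D.isSmoothProjective γ e = e} := by
  obtain ⟨γ, hγ, hrat, hfix⟩ := exists_diagonal_envelope ratFamily D.isSmoothProjective c
  exact Submodule.mem_sup_right
    (Submodule.subset_span ⟨hc, ratFamily, OrientationFamily.hasPoincareDuality _, γ, hγ, hrat, hfix⟩)

/-- F3(c): WITHOUT "`γ` algebraic", every ANISOTROPIC rational class `e` (`e ∪ e ≠ 0`) is enveloped, for
every orientation family: `γ := (pr₁₊pr₂^*(e ∪ e))⁻¹ • pr₁^* e ∪ pr₂^* e` acts by `β ↦ (⟨β,e⟩/⟨e,e⟩) e`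
(sibling `exists_pc_crossSq_eq_smul`), preserves rational classes (comparison with `ratFamily`), is
`ℂ e`-valued and fixes `e`; algebraicity of `e` — hence of `γ` — is never used. `ht`: the fibre integral
`pr₁₊pr₂^*` is non-zero on `H^{top}(X(ℂ))` (Künneth), explicit as in the sibling file.
[cite: VoisinHodgeII2003, proof of Thm. 10.17 (10.7)] [cite: FultonYoungTableaux1997, Appendix B §B.1 (5)–(6)] -/
theorem exists_crossSq_envelope_withoutAlgebraic (μ : OrientationFamily)
    (hX : IsSmoothProjective (2 * (m + 1)) X)
    (ht : ∃ ω : complexBetti X (2 * (2 * (m + 1))), fibreIntegral μ hX ω ≠ 0)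
    {e : complexBetti X (2 * (m + 1))} (he : IsRationalClass e)
    (hee : cupProduct (two_add_two m) e e ≠ 0) :
    ∃ c : ℂ, (∀ β, IsRationalClass β → IsRationalClass (Pc μ hX (c • crossSq e) β)) ∧
      (∀ β, ∃ s : ℂ, Pc μ hX (c • crossSq e) β = s • e) ∧
      Pc μ hX (c • crossSq e) e = e := by
  classical
  have hμ : μ.HasPoincareDuality := OrientationFamily.hasPoincareDuality μ
  have hne : e ≠ 0 := by rintro rfl; exact hee (by rw [map_zero])
  choose s hs1 hs2 using exists_pc_crossSq_eq_smul μ hX e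
  obtain ⟨ω, hω⟩ := ht
  have hω0 : ω ≠ 0 := by rintro rfl; exact hω (map_zero _)
  obtain ⟨r, hr⟩ := exists_eq_smul_of_top μ hX hω0 (cupProduct (two_add_two m) e e)
  have hr0 : r ≠ 0 := by rintro rfl; exact hee (by rw [hr, zero_smul])
  have hse : s e ≠ 0 := by
    intro h0
    have h1 := hs1 e
    rw [h0, zero_smul, hr, map_smul] at h1
    exact (smul_ne_zero hr0 hω) h1
  obtain ⟨c, hc0, hc⟩ := corrAction_eq_smul_of_orientationFamily
    (OrientationFamily.hasPoincareDuality ratFamily) hμ hX hX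
    (rfl : 2 * (m + 1) + 2 * (2 * (m + 1)) = 2 * (m + 1) + 2 * (2 * (m + 1)))
  have hrat : ∀ β, IsRationalClass β → ∃ q : ℚ, (q : ℂ) = c⁻¹ * s β := by
    intro β hβ
    refine exists_ratCast_eq_of_isRationalClass_smul he hne ?_
    have h2 : Pc μ hX (crossSq e) β = c • Pc ratFamily hX (crossSq e) β := by
      change corrAction μ hX hX rfl (crossSq e) β = c • corrAction ratFamily hX hX rfl (crossSq e) β
      rw [hc, LinearMap.smul_apply, LinearMap.smul_apply]
    have h3 : (c⁻¹ * s β) • e = Pc ratFamily hX (crossSq e) β := by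
      rw [mul_smul, ← hs2 β, h2, smul_smul, inv_mul_cancel₀ hc0, one_smul]
    rw [h3]
    exact isRationalClass_pc_ratFamily_crossSq hX he hβ
  have h4 : ∀ β, Pc μ hX ((s e)⁻¹ • crossSq e) β = ((s e)⁻¹ * s β) • e := by
    intro β
    change corrAction μ hX hX rfl ((s e)⁻¹ • crossSq e) β = _
    rw [map_smul, LinearMap.smul_apply, mul_smul]
    exact congrArg _ (hs2 β)
  refine ⟨(s e)⁻¹, ?_, fun β ↦ ⟨_, h4 β⟩, ?_⟩
  · intro β hβ
    obtain ⟨qβ, hqβ⟩ := hrat β hβ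
    obtain ⟨qe, hqe⟩ := hrat e he
    have hq : ((qβ / qe : ℚ) : ℂ) = (s e)⁻¹ * s β := by
      push_cast
      rw [hqβ, hqe]
      field_simp
    rw [h4, ← hq]
    exact he.smul _
  · rw [h4, inv_mul_cancel₀ hse, one_smul]

/-- F3(c), with the Hodge clause: an anisotropic rational `(n,n)`-class is enveloped by a class `γ` that
is NOT asked to be algebraic — the full envelope clause minus "`γ ∈ algebraicClasses`".
[cite: VoisinHodgeII2003, proof of Thm. 10.17 (10.7)] -/
theorem envelope_withoutAlgebraic_of_anisotropic (μ : OrientationFamily)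
    (hX : IsSmoothProjective (2 * (m + 1)) X)
    (ht : ∃ ω : complexBetti X (2 * (2 * (m + 1))), fibreIntegral μ hX ω ≠ 0)
    {e : complexBetti X (2 * (m + 1))} (he : IsRationalClass e)
    (htyp : IsOfHodgeType (2 * (m + 1)) X (2 * (m + 1)) (m + 1) (m + 1) e)
    (hee : cupProduct (two_add_two m) e e ≠ 0) :
    ∃ γ : complexBetti (X ⊗ X) (2 * (2 * (m + 1))),
      (∀ β, IsRationalClass β → IsRationalClass (Pc μ hX γ β)) ∧
      (∀ β, IsOfHodgeType (2 * (m + 1)) X (2 * (m + 1)) (m + 1) (m + 1) (Pc μ hX γ β)) ∧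
      Pc μ hX γ e = e := by
  obtain ⟨c, hR, hline, hfix⟩ := exists_crossSq_envelope_withoutAlgebraic μ hX ht he hee
  obtain ⟨A, hA⟩ := htyp
  refine ⟨c • crossSq e, hR, fun β ↦ ⟨A, ?_⟩, hfix⟩
  obtain ⟨s, hs⟩ := hline β
  rw [hs, map_smul]
  exact Submodule.smul_mem _ _ hA

/-! ## F4 — line `Sketch`: retract hulls kill the shadow kernel -/

/-- F4: a Gysin morphism with a retraction is injective (`r_* ∘ ι_* = (ι ≫ r)_* = id`).
[cite: FultonYoungTableaux1997, Appendix B §B.1 (2) and (5)] -/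
theorem eq_zero_of_complexGysin_eq_zero_of_retract (μ : OrientationFamily) {d d' : ℕ}
    {X X' : SchemeOver ℂ} (hX : IsSmoothProjective d X) (hX' : IsSmoothProjective d' X')
    (ι : X ⟶ X') (r : X' ⟶ X) (hιr : ι ≫ r = 𝟙 X) {a b : ℕ} (hab : a + 2 * d' = b + 2 * d)
    {e : complexBetti X a} (he : complexGysin μ hX hX' ι hab e = 0) : e = 0 := by
  have hcomp := complexGysin_comp μ.hasPoincareDuality hX hX' hX ι r hab
    (show b + 2 * d = a + 2 * d' by omega)
  rw [hιr, complexGysin_id μ.hasPoincareDuality hX a] at hcomp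
  have h := LinearMap.congr_fun hcomp e
  rw [LinearMap.id_apply, LinearMap.comp_apply, he, map_zero] at h
  exact h

/-- F4: the product hull `X ⊗ ℙ^{m+1} ⊇ X × {pt}` is a smooth projective `3(m+1)`-fold retracting onto
`X`. [folklore] -/
theorem exists_product_retract (hX : IsSmoothProjective (2 * (m + 1)) X) :
    ∃ (X' : SchemeOver ℂ) (_ : IsSmoothProjective (3 * (m + 1)) X') (ι : X ⟶ X') (r : X' ⟶ X),
      ι ≫ r = 𝟙 X := by
  obtain ⟨y, -⟩ := exists_unit_hom_projectiveSpace_isClosedImmersion (m + 1) ℂ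
  have hP : IsSmoothProjective (m + 1) (projectiveSpace (m + 1) ℂ) :=
    isSmoothProjective_projectiveSpace_holds ℂ (m + 1)
  have hXP : IsSmoothProjective (3 * (m + 1)) (X ⊗ projectiveSpace (m + 1) ℂ) := by
    rw [show 3 * (m + 1) = 2 * (m + 1) + (m + 1) by ring]
    exact IsSmoothProjective.tensor_holds hX hP
  exact ⟨X ⊗ projectiveSpace (m + 1) ℂ, hXP, lift (𝟙 X) (toUnit X ≫ y), fst X _, lift_fst _ _⟩

/-- F4: ONE admissible retract hull forces the shadow kernel (hypothesis of `stub_shadowKernelEnveloped`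
verbatim) to vanish. [cite: FultonYoungTableaux1997, Appendix B §B.1 (2) and (5)] -/
theorem shadowKernel_eq_zero_of_admissible_retract (μ : OrientationFamily)
    (hX : IsSmoothProjective (2 * (m + 1)) X) {e : complexBetti X (2 * (m + 1))}
    (hsh : ∀ (X' : SchemeOver ℂ) (hX' : IsSmoothProjective (3 * (m + 1)) X') (ι : X ⟶ X'),
      (∀ a : complexBetti X' (2 * (m + 1)), IsRationalClass a →
        IsOfHodgeType (3 * (m + 1)) X' (2 * (m + 1)) (m + 1) (m + 1) a →
        a ∈ algebraicClasses X' (m + 1)) →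
      complexGysin μ hX hX' ι
        (show 2 * (m + 1) + 2 * (3 * (m + 1)) = 2 * (2 * (m + 1)) + 2 * (2 * (m + 1)) by ring) e = 0)
    (X' : SchemeOver ℂ) (hX' : IsSmoothProjective (3 * (m + 1)) X') (ι : X ⟶ X') (r : X' ⟶ X)
    (hιr : ι ≫ r = 𝟙 X)
    (hHC' : ∀ a : complexBetti X' (2 * (m + 1)), IsRationalClass a →
      IsOfHodgeType (3 * (m + 1)) X' (2 * (m + 1)) (m + 1) (m + 1) a →
      a ∈ algebraicClasses X' (m + 1)) :
    e = 0 :=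
  eq_zero_of_complexGysin_eq_zero_of_retract μ hX hX' ι r hιr _ (hsh X' hX' ι hHC')

/-- F4: under HC the shadow kernel is `{0}` — the bet `ShadowKernelEnveloped` is HC-vacuous, never
HC-false. [cite: Deligne2000, §1] -/
theorem shadowKernel_eq_zero_of_hodgeConjecture (hHC : _root_.HodgeConjecture) (μ : OrientationFamily)
    (hX : IsSmoothProjective (2 * (m + 1)) X) {e : complexBetti X (2 * (m + 1))}
    (hsh : ∀ (X' : SchemeOver ℂ) (hX' : IsSmoothProjective (3 * (m + 1)) X') (ι : X ⟶ X'),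
      (∀ a : complexBetti X' (2 * (m + 1)), IsRationalClass a →
        IsOfHodgeType (3 * (m + 1)) X' (2 * (m + 1)) (m + 1) (m + 1) a →
        a ∈ algebraicClasses X' (m + 1)) →
      complexGysin μ hX hX' ι
        (show 2 * (m + 1) + 2 * (3 * (m + 1)) = 2 * (2 * (m + 1)) + 2 * (2 * (m + 1)) by ring) e = 0) :
    e = 0 := by
  obtain ⟨X', hX', ι, r, hιr⟩ := exists_product_retract hX
  exact shadowKernel_eq_zero_of_admissible_retract μ hX hsh X' hX' ι r hιr
    fun a ha hH ↦ (hHC hX').2 (m + 1) a ha hH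

/-- F4: line-level ceiling — a non-zero shadow-kernel class refutes HC. [cite: Deligne2000, §1] -/
theorem not_hodgeConjecture_of_shadowKernel_ne_zero (μ : OrientationFamily)
    (hX : IsSmoothProjective (2 * (m + 1)) X) {e : complexBetti X (2 * (m + 1))} (he : e ≠ 0)
    (hsh : ∀ (X' : SchemeOver ℂ) (hX' : IsSmoothProjective (3 * (m + 1)) X') (ι : X ⟶ X'),
      (∀ a : complexBetti X' (2 * (m + 1)), IsRationalClass a →
        IsOfHodgeType (3 * (m + 1)) X' (2 * (m + 1)) (m + 1) (m + 1) a →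
        a ∈ algebraicClasses X' (m + 1)) →
      complexGysin μ hX hX' ι
        (show 2 * (m + 1) + 2 * (3 * (m + 1)) = 2 * (2 * (m + 1)) + 2 * (2 * (m + 1)) by ring) e = 0) :
    ¬ _root_.HodgeConjecture :=
  fun hHC ↦ he (shadowKernel_eq_zero_of_hodgeConjecture hHC μ hX hsh)

/-- F4: the zero class is enveloped (`γ = 0`, `P = 0`) as soon as a Hodge model exists — which is why a
vanishing shadow kernel makes the bet vacuous rather than false. [folklore] -/
theorem zero_enveloped (μ : OrientationFamily) (hX : IsSmoothProjective (2 * (m + 1)) X)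
    (A : HodgeModel (2 * (m + 1)) X) :
    ∃ γ ∈ algebraicClasses (X ⊗ X) (2 * (m + 1)),
      (∀ β, IsRationalClass β → IsRationalClass (Pc μ hX γ β)) ∧
      (∀ β, IsOfHodgeType (2 * (m + 1)) X (2 * (m + 1)) (m + 1) (m + 1) (Pc μ hX γ β)) ∧
      Pc μ hX γ 0 = 0 := by
  have h0 : Pc μ hX 0 = 0 :=
    map_zero (corrAction μ hX hX (rfl : 2 * (m + 1) + 2 * (2 * (m + 1)) = 2 * (m + 1) + 2 * (2 * (m + 1))))
  refine ⟨0, Submodule.zero_mem _, fun β _ ↦ ?_, fun β ↦ ?_, ?_⟩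
  · rw [h0, LinearMap.zero_apply]; exact IsRationalClass.zero
  · rw [h0, LinearMap.zero_apply]; exact IsOfHodgeType.zero A _ _ _
  · rw [h0, LinearMap.zero_apply]

/-! ## F4 — the registered stubs of line `Sketch`, verbatim, under HC

The crux workfiles `Lines/Sketch.lean` / `Lines/Sketch_remarks.lean` are not built on the farm, so the
line vocabulary (`ShadowKernel`, `IsEnveloped`, `ShadowKernelEnveloped`, `HullShadowSplit`) is used here
UNFOLDED, exactly as the registered stubs spell it (tree vocabulary only). -/

/-- F4: **HC ⟹ `stub_shadowKernelEnveloped` (THE BET), vacuously.** The statement below is the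
registered stub's signature verbatim; under HC its shadow-kernel hypothesis forces `e = 0`
(retract hull `X ⊗ ℙ^{m+1}`) and `γ = 0` envelopes `0`. So the bet is HC-implied like the crux: no
refutation short of `¬HC`, no small model, no degenerate case. [cite: Deligne2000, §1] -/
theorem stub_shadowKernelEnveloped_of_hodgeConjecture (hHC : _root_.HodgeConjecture) :
    ∀ (μ : OrientationFamily), μ.HasPoincareDuality →
    ∀ (m : ℕ) (X : SchemeOver ℂ) (D : UnitaryBallQuotientDatum (2 * (m + 1)) X), 1 ≤ m → m ≤ 2 →
    (∀ a : complexBetti X (2 * m), IsRationalClass a →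
      IsOfHodgeType (2 * (m + 1)) X (2 * m) m m a → a ∈ algebraicClasses X m) →
    ∀ e : complexBetti X (2 * (m + 1)), IsRationalClass e →
      IsOfHodgeType (2 * (m + 1)) X (2 * (m + 1)) (m + 1) (m + 1) e →
      (∀ (X' : SchemeOver ℂ) (hX' : IsSmoothProjective (3 * (m + 1)) X') (ι : X ⟶ X'),
        (∀ a : complexBetti X' (2 * (m + 1)), IsRationalClass a →
          IsOfHodgeType (3 * (m + 1)) X' (2 * (m + 1)) (m + 1) (m + 1) a →
          a ∈ algebraicClasses X' (m + 1)) →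
        complexGysin μ D.isSmoothProjective hX' ι
          (show 2 * (m + 1) + 2 * (3 * (m + 1)) = 2 * (2 * (m + 1)) + 2 * (2 * (m + 1)) by ring) e = 0) →
      ∃ γ ∈ algebraicClasses (X ⊗ X) (2 * (m + 1)),
        (∀ β, IsRationalClass β → IsRationalClass
          (complexGysin μ
            (IsSmoothProjective.tensor_holds D.isSmoothProjective D.isSmoothProjective)
            D.isSmoothProjective (fst X X)
            (show 2 * (m + 1) + 2 * (2 * (m + 1)) + 2 * (2 * (m + 1)) =
              2 * (m + 1) + 2 * (2 * (m + 1) + 2 * (m + 1)) by ring)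
            (cupProduct (rfl : 2 * (m + 1) + 2 * (2 * (m + 1)) = 2 * (m + 1) + 2 * (2 * (m + 1)))
              (complexBetti.map (snd X X) (2 * (m + 1)) β) γ))) ∧
        (∀ β, IsOfHodgeType (2 * (m + 1)) X (2 * (m + 1)) (m + 1) (m + 1)
          (complexGysin μ
            (IsSmoothProjective.tensor_holds D.isSmoothProjective D.isSmoothProjective)
            D.isSmoothProjective (fst X X)
            (show 2 * (m + 1) + 2 * (2 * (m + 1)) + 2 * (2 * (m + 1)) =
              2 * (m + 1) + 2 * (2 * (m + 1) + 2 * (m + 1)) by ring)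
            (cupProduct (rfl : 2 * (m + 1) + 2 * (2 * (m + 1)) = 2 * (m + 1) + 2 * (2 * (m + 1)))
              (complexBetti.map (snd X X) (2 * (m + 1)) β) γ))) ∧
        (complexGysin μ
            (IsSmoothProjective.tensor_holds D.isSmoothProjective D.isSmoothProjective)
            D.isSmoothProjective (fst X X)
            (show 2 * (m + 1) + 2 * (2 * (m + 1)) + 2 * (2 * (m + 1)) =
              2 * (m + 1) + 2 * (2 * (m + 1) + 2 * (m + 1)) by ring)
            (cupProduct (rfl : 2 * (m + 1) + 2 * (2 * (m + 1)) = 2 * (m + 1) + 2 * (2 * (m + 1)))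
              (complexBetti.map (snd X X) (2 * (m + 1)) e) γ)) = e := by
  intro μ _ m X D _ _ _ e _ heH hsh
  obtain rfl : e = 0 := shadowKernel_eq_zero_of_hodgeConjecture hHC μ D.isSmoothProjective hsh
  obtain ⟨A, _⟩ := heH
  exact zero_enveloped μ D.isSmoothProjective A

/-- F4: **HC ⟹ the visible half `HullShadowSplit`** (its statement verbatim, shadow kernel unfolded),
by `mem_sup_left` — target-implied like the crux. [cite: Deligne2000, §1] -/
theorem hullShadowSplit_of_hodgeConjecture (hHC : _root_.HodgeConjecture) :
    ∀ (m : ℕ) (X : SchemeOver ℂ) (D : UnitaryBallQuotientDatum (2 * (m + 1)) X), 1 ≤ m → m ≤ 2 →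
    (∀ a : complexBetti X (2 * m), IsRationalClass a →
      IsOfHodgeType (2 * (m + 1)) X (2 * m) m m a → a ∈ algebraicClasses X m) →
    ∀ c : complexBetti X (2 * (m + 1)), IsRationalClass c →
      IsOfHodgeType (2 * (m + 1)) X (2 * (m + 1)) (m + 1) (m + 1) c →
      c ∈ algebraicClasses X (m + 1) ⊔ Submodule.span ℂ {e : complexBetti X (2 * (m + 1)) |
        IsRationalClass e ∧ IsOfHodgeType (2 * (m + 1)) X (2 * (m + 1)) (m + 1) (m + 1) e ∧
        ∃ μ : OrientationFamily, μ.HasPoincareDuality ∧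
          ∀ (X' : SchemeOver ℂ) (hX' : IsSmoothProjective (3 * (m + 1)) X') (ι : X ⟶ X'),
            (∀ a : complexBetti X' (2 * (m + 1)), IsRationalClass a →
              IsOfHodgeType (3 * (m + 1)) X' (2 * (m + 1)) (m + 1) (m + 1) a →
              a ∈ algebraicClasses X' (m + 1)) →
            complexGysin μ D.isSmoothProjective hX' ι
              (show 2 * (m + 1) + 2 * (3 * (m + 1)) = 2 * (2 * (m + 1)) + 2 * (2 * (m + 1)) by ring)
              e = 0} :=
  fun _ _ D _ _ _ c hc hH ↦ Submodule.mem_sup_left ((hHC D.isSmoothProjective).2 _ c hc hH)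

/-- F4: **under HC the shadow-kernel span of `HullShadowSplit` is `⊥`-generated** (every generator is
`0`), so the split degenerates to `c ∈ algebraicClasses X (m+1)` = the target on `X`.
[cite: Deligne2000, §1] -/
theorem shadowKernel_generators_subset_zero_of_hodgeConjecture (hHC : _root_.HodgeConjecture)
    (m : ℕ) (X : SchemeOver ℂ) (hX : IsSmoothProjective (2 * (m + 1)) X) :
    {e : complexBetti X (2 * (m + 1)) |
        IsRationalClass e ∧ IsOfHodgeType (2 * (m + 1)) X (2 * (m + 1)) (m + 1) (m + 1) e ∧
        ∃ μ : OrientationFamily, μ.HasPoincareDuality ∧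
          ∀ (X' : SchemeOver ℂ) (hX' : IsSmoothProjective (3 * (m + 1)) X') (ι : X ⟶ X'),
            (∀ a : complexBetti X' (2 * (m + 1)), IsRationalClass a →
              IsOfHodgeType (3 * (m + 1)) X' (2 * (m + 1)) (m + 1) (m + 1) a →
              a ∈ algebraicClasses X' (m + 1)) →
            complexGysin μ hX hX' ι
              (show 2 * (m + 1) + 2 * (3 * (m + 1)) = 2 * (2 * (m + 1)) + 2 * (2 * (m + 1)) by ring)
              e = 0} ⊆ {0} := by
  rintro e ⟨-, -, μ, -, hsh⟩
  exact shadowKernel_eq_zero_of_hodgeConjecture hHC μ hX hsh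

/-- F4, contrapositive for the lead: if the bet (stub signature verbatim) fails, HC fails.
[cite: Deligne2000, §1] -/
theorem not_hodgeConjecture_of_not_stub_shadowKernelEnveloped
    (h : ¬ ∀ (μ : OrientationFamily), μ.HasPoincareDuality →
    ∀ (m : ℕ) (X : SchemeOver ℂ) (D : UnitaryBallQuotientDatum (2 * (m + 1)) X), 1 ≤ m → m ≤ 2 →
    (∀ a : complexBetti X (2 * m), IsRationalClass a →
      IsOfHodgeType (2 * (m + 1)) X (2 * m) m m a → a ∈ algebraicClasses X m) →
    ∀ e : complexBetti X (2 * (m + 1)), IsRationalClass e →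
      IsOfHodgeType (2 * (m + 1)) X (2 * (m + 1)) (m + 1) (m + 1) e →
      (∀ (X' : SchemeOver ℂ) (hX' : IsSmoothProjective (3 * (m + 1)) X') (ι : X ⟶ X'),
        (∀ a : complexBetti X' (2 * (m + 1)), IsRationalClass a →
          IsOfHodgeType (3 * (m + 1)) X' (2 * (m + 1)) (m + 1) (m + 1) a →
          a ∈ algebraicClasses X' (m + 1)) →
        complexGysin μ D.isSmoothProjective hX' ι
          (show 2 * (m + 1) + 2 * (3 * (m + 1)) = 2 * (2 * (m + 1)) + 2 * (2 * (m + 1)) by ring) e = 0) →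
      ∃ γ ∈ algebraicClasses (X ⊗ X) (2 * (m + 1)),
        (∀ β, IsRationalClass β → IsRationalClass (Pc μ D.isSmoothProjective γ β)) ∧
        (∀ β, IsOfHodgeType (2 * (m + 1)) X (2 * (m + 1)) (m + 1) (m + 1)
          (Pc μ D.isSmoothProjective γ β)) ∧
        Pc μ D.isSmoothProjective γ e = e) :
    ¬ _root_.HodgeConjecture :=
  fun hHC ↦ h (stub_shadowKernelEnveloped_of_hodgeConjecture hHC)

end Summit.HodgeConjecture.HodgeConjecture.Cruxes.AlgebraicOrEnveloped.Disproof

end
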